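import Summits.Ventures.CertifiedManyBodySolver.Downfold.OneBandCellTree
import HarnessLib

/-!
# The direct one-band band on a RECTANGULAR (orthorhombic) lattice: asymmetric shell list, harmonic form, polynomial form,
# derivatives and `ArithExpr` mirrors

Venture CertifiedManyBodySolver, cell `pub/hubbard-downfold` (stage S1, technique B), seat hubbard-downfold-mod-4 (g25);
namespace `Summit.Ventures.CertifiedManyBodySolver.Downfold.Emery`. Everything PROVED; no number lives here. WHAT THIS IS NOT:
a statement about any material; `U = 0` one-body kinematics of a one-band Wannier Hamiltonian.

`OneBandInPlane.ipBandK` assumes TETRAGONAL stars (`H(m a, n a) = H(n a, m a)`). The plane of an orthorhombic cuprate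
(YBa₂Cu₃O₇: a ≠ b, chains along b) has `H(m, n) ≠ H(n, m)`: the one-band dispersion is
`ε(k) = Σ_{m,n ≥ 0} h_{mn}·c_m(kx)·c_n(ky)` with `c_0 = 1`, `c_m(k) = 2 cos(m k)` (the D₂ₕ star of `(±m, ±n)`), one amplitude
per ORDERED pair. This file is the rectangular analogue of `OneBandInPlane` §2–§3 + `OneBandInPlaneExpr`:

* §1 `rectStar`, `rbBandK H kx ky`, the transpose `rbT H` with `rbBandK H kx ky = rbBandK (rbT H) ky kx`, the dictionary
  `ipBandK S = rbBandK (rbOfShells S)` is NOT needed and not stated; `rbBandK_X/Y` values at X = (π, 0), Y = (0, π).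
* §2 the `kx`-derivative `rbBandDx` (`hasDerivAt_rbBandK_kx`), the `ky`-derivative via the transpose, continuity.
* §3 the polynomial form `rbBandUV H u v` in `u = cos kx`, `v = cos ky` (`rbBandK_eq_UV`, shells `m, n ≤ 4`), its
  `u`-derivative `rbBandU` (`hasDerivAt_rbBandUV`), `v`-derivative via transpose, exact rational evaluation `rbBandQ`,
  and `ArithExpr` mirrors `rbBandE`, `rbBandUE`, `rbBandVE` (variables `0 ↦ u`, `1 ↦ v`) with `eval` lemmas.

Sources: one-band `t–t′–t″…` form [AndersenEtAl1995, §6]; interval/box verification [Moore1966, Theorem 3.1, §4.4].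
-/

noncomputable section

namespace Summit.Ventures.CertifiedManyBodySolver.Downfold.Emery

open Real Set Literature.Analysis.ValidatedNumerics

/-! ## §1 Rectangular stars and the band -/

/-- The axis factor `c_m(k)`: `1` for `m = 0`, `2 cos(m k)` otherwise. [folklore] -/
def axisFac (m : ℕ) (k : ℝ) : ℝ := if m = 0 then 1 else 2 * cos (m * k)

/-- The D₂ₕ star of the ordered in-plane vector `(m a, n b)`: `c_m(kx)·c_n(ky)`. [cite: AndersenEtAl1995, §6] -/
def rectStar (m n : ℕ) (kx ky : ℝ) : ℝ := axisFac m kx * axisFac n ky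

/-- **The rectangular one-band dispersion** of an ORDERED shell list `H = [(m, n, h_mn), …]`:
`ε(k) = Σ h_mn · c_m(kx) · c_n(ky)`. [cite: AndersenEtAl1995, §6] -/
def rbBandK (H : List (ℕ × ℕ × ℚ)) (kx ky : ℝ) : ℝ :=
  (H.map fun s => (s.2.2 : ℝ) * rectStar s.1 s.2.1 kx ky).sum

/-- The transposed shell list `(m, n, h) ↦ (n, m, h)`. [folklore] -/
def rbT (H : List (ℕ × ℕ × ℚ)) : List (ℕ × ℕ × ℚ) := H.map fun s => (s.2.1, s.1, s.2.2)

/-- `rectStar m n kx ky = rectStar n m ky kx`. [folklore] -/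
theorem rectStar_swap (m n : ℕ) (kx ky : ℝ) : rectStar m n kx ky = rectStar n m ky kx := by
  unfold rectStar; ring

/-- **Transpose symmetry**: `ε_H(kx, ky) = ε_{Hᵀ}(ky, kx)`. [folklore] -/
theorem rbBandK_transpose (H : List (ℕ × ℕ × ℚ)) (kx ky : ℝ) : rbBandK H kx ky = rbBandK (rbT H) ky kx := by
  induction H with
  | nil => simp [rbBandK, rbT]
  | cons s H ih =>
    simp only [rbBandK, rbT, List.map_cons, List.sum_cons, List.map_map] at ih ⊢
    rw [rectStar_swap, ih]

/-- `rbT (rbT H) = H`. [folklore] -/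
theorem rbT_rbT (H : List (ℕ × ℕ × ℚ)) : rbT (rbT H) = H := by
  induction H with
  | nil => rfl
  | cons s H ih => simp only [rbT, List.map_cons, List.map_map] at ih ⊢; exact congrArg _ (by simpa [rbT, List.map_map] using ih)

/-! ## §2 Derivatives -/

/-- `d/dk c_m(k)`: `0` for `m = 0`, `−2m sin(m k)` otherwise. [folklore] -/
def dAxisFac (m : ℕ) (k : ℝ) : ℝ := if m = 0 then 0 else 2 * (-(m : ℝ) * sin (m * k))

/-- [folklore] -/
theorem hasDerivAt_axisFac (m : ℕ) (k : ℝ) : HasDerivAt (fun k => axisFac m k) (dAxisFac m k) k := by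
  unfold axisFac dAxisFac
  by_cases hm : m = 0
  · simp only [hm, if_true]; exact hasDerivAt_const k 1
  · simp only [hm, if_false]; exact (hasDerivAt_cos_natMul m k).const_mul 2

/-- [folklore] -/
theorem continuous_axisFac (m : ℕ) : Continuous (fun k => axisFac m k) :=
  continuous_iff_continuousAt.2 fun k => (hasDerivAt_axisFac m k).continuousAt

/-- `∂/∂kx` of the rectangular star. [folklore] -/
def dRectStarKx (m n : ℕ) (kx ky : ℝ) : ℝ := dAxisFac m kx * axisFac n ky

/-- [folklore] -/
theorem hasDerivAt_rectStar_kx (m n : ℕ) (kx ky : ℝ) :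
    HasDerivAt (fun kx => rectStar m n kx ky) (dRectStarKx m n kx ky) kx := by
  unfold rectStar dRectStarKx; exact (hasDerivAt_axisFac m kx).mul_const _

/-- **`∂ε/∂kx`** of the rectangular band. [folklore] -/
def rbBandDx (H : List (ℕ × ℕ × ℚ)) (kx ky : ℝ) : ℝ :=
  (H.map fun s => (s.2.2 : ℝ) * dRectStarKx s.1 s.2.1 kx ky).sum

/-- [folklore] -/
theorem hasDerivAt_rbBandK_kx (H : List (ℕ × ℕ × ℚ)) (kx ky : ℝ) :
    HasDerivAt (fun kx => rbBandK H kx ky) (rbBandDx H kx ky) kx := by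
  induction H with
  | nil => simp only [rbBandK, rbBandDx, List.map_nil, List.sum_nil]; exact hasDerivAt_const kx (0 : ℝ)
  | cons s H ih =>
    have h := ((hasDerivAt_rectStar_kx s.1 s.2.1 kx ky).const_mul (s.2.2 : ℝ)).add ih
    simp only [rbBandK, rbBandDx, List.map_cons, List.sum_cons]
    exact h

/-- **`∂ε/∂ky (kx, ky) = rbBandDx (rbT H) ky kx`.** [folklore] -/
theorem hasDerivAt_rbBandK_ky (H : List (ℕ × ℕ × ℚ)) (kx ky : ℝ) :
    HasDerivAt (fun ky => rbBandK H kx ky) (rbBandDx (rbT H) ky kx) ky := by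
  have hf : (fun ky => rbBandK H kx ky) = fun ky => rbBandK (rbT H) ky kx := funext fun k => rbBandK_transpose H kx k
  rw [hf]; exact hasDerivAt_rbBandK_kx (rbT H) ky kx

/-- [folklore] -/
theorem continuous_rbBandK_kx (H : List (ℕ × ℕ × ℚ)) (ky : ℝ) : Continuous (fun kx => rbBandK H kx ky) :=
  continuous_iff_continuousAt.2 fun kx => (hasDerivAt_rbBandK_kx H kx ky).continuousAt

/-- [folklore] -/
theorem continuous_rbBandK_ky (H : List (ℕ × ℕ × ℚ)) (kx : ℝ) : Continuous (fun ky => rbBandK H kx ky) :=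
  continuous_iff_continuousAt.2 fun ky => (hasDerivAt_rbBandK_ky H kx ky).continuousAt

/-! ## §3 Polynomial form in `u = cos kx`, `v = cos ky`, and `ArithExpr` mirrors -/

/-- Polynomial axis factor: `1` (`m = 0`) or `2·T_m(u)`. [folklore] -/
def axisFacUV (m : ℕ) (u : ℝ) : ℝ := if m = 0 then 1 else 2 * cheb m u

/-- Its `u`-derivative: `0` or `2·T_m′(u)`. [folklore] -/
def dAxisFacUV (m : ℕ) (u : ℝ) : ℝ := if m = 0 then 0 else 2 * dcheb m u

/-- Rational twin. [folklore] -/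
def axisFacQ (m : ℕ) (u : ℚ) : ℚ := if m = 0 then 1 else 2 * chebQ m u

/-- [folklore] -/
theorem axisFac_eq_UV {m : ℕ} (hm : m ≤ 4) (k : ℝ) : axisFac m k = axisFacUV m (cos k) := by
  unfold axisFac axisFacUV; split_ifs <;> simp [cheb_cos hm]

/-- [folklore] -/
theorem cast_axisFacQ (m : ℕ) (u : ℚ) : ((axisFacQ m u : ℚ) : ℝ) = axisFacUV m u := by
  unfold axisFacQ axisFacUV; split_ifs <;> push_cast [cast_chebQ] <;> ring

/-- [folklore] -/
theorem hasDerivAt_axisFacUV (m : ℕ) (u : ℝ) : HasDerivAt (fun u => axisFacUV m u) (dAxisFacUV m u) u := by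
  unfold axisFacUV dAxisFacUV
  split_ifs with hm
  · exact hasDerivAt_const u 1
  · exact (hasDerivAt_cheb m u).const_mul 2

/-- The polynomial form of the band. [folklore] -/
def rbBandUV (H : List (ℕ × ℕ × ℚ)) (u v : ℝ) : ℝ :=
  (H.map fun s => (s.2.2 : ℝ) * (axisFacUV s.1 u * axisFacUV s.2.1 v)).sum

/-- Exact rational evaluation. [folklore] -/
def rbBandQ (H : List (ℕ × ℕ × ℚ)) (u v : ℚ) : ℚ :=
  (H.map fun s => s.2.2 * (axisFacQ s.1 u * axisFacQ s.2.1 v)).sum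

/-- [folklore] -/
theorem cast_rbBandQ (H : List (ℕ × ℕ × ℚ)) (u v : ℚ) : ((rbBandQ H u v : ℚ) : ℝ) = rbBandUV H u v := by
  induction H with
  | nil => simp [rbBandQ, rbBandUV]
  | cons s H ih =>
    simp only [rbBandQ, rbBandUV, List.map_cons, List.sum_cons, Rat.cast_add, Rat.cast_mul, cast_axisFacQ] at ih ⊢
    rw [ih]

/-- **`ε(k) = rbBandUV(cos kx, cos ky)`** for shells with `m, n ≤ 4` (`shellsOK`). [folklore] -/
theorem rbBandK_eq_UV {H : List (ℕ × ℕ × ℚ)} (hH : shellsOK H = true) (kx ky : ℝ) :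
    rbBandK H kx ky = rbBandUV H (cos kx) (cos ky) := by
  induction H with
  | nil => simp [rbBandK, rbBandUV]
  | cons s H ih =>
    simp only [shellsOK, List.all_cons, Bool.and_eq_true, decide_eq_true_eq] at hH
    have ih' := ih (by simpa [shellsOK] using hH.2)
    simp only [rbBandK, rbBandUV, List.map_cons, List.sum_cons] at ih' ⊢
    rw [ih']; unfold rectStar; rw [axisFac_eq_UV hH.1.1, axisFac_eq_UV hH.1.2]

/-- `shellsOK` is transpose-invariant. [folklore] -/
theorem shellsOK_rbT {H : List (ℕ × ℕ × ℚ)} (hH : shellsOK H = true) : shellsOK (rbT H) = true := by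
  induction H with
  | nil => rfl
  | cons s H ih =>
    simp only [shellsOK, rbT, List.all_cons, List.map_cons, Bool.and_eq_true, decide_eq_true_eq] at hH ⊢
    exact ⟨⟨hH.1.2, hH.1.1⟩, by simpa [shellsOK, rbT] using ih (by simpa [shellsOK] using hH.2)⟩

/-- The polynomial form is transpose-symmetric: `rbBandUV H u v = rbBandUV (rbT H) v u`. [folklore] -/
theorem rbBandUV_transpose (H : List (ℕ × ℕ × ℚ)) (u v : ℝ) : rbBandUV H u v = rbBandUV (rbT H) v u := by
  induction H with
  | nil => simp [rbBandUV, rbT]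
  | cons s H ih =>
    simp only [rbBandUV, rbT, List.map_cons, List.sum_cons, List.map_map] at ih ⊢
    rw [mul_comm (axisFacUV s.1 u), ih]

/-- **`∂ε/∂u`** of the polynomial form. [folklore] -/
def rbBandU (H : List (ℕ × ℕ × ℚ)) (u v : ℝ) : ℝ :=
  (H.map fun s => (s.2.2 : ℝ) * (dAxisFacUV s.1 u * axisFacUV s.2.1 v)).sum

/-- [folklore] -/
theorem hasDerivAt_rbBandUV (H : List (ℕ × ℕ × ℚ)) (u v : ℝ) :
    HasDerivAt (fun u => rbBandUV H u v) (rbBandU H u v) u := by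
  induction H with
  | nil => simp only [rbBandUV, rbBandU, List.map_nil, List.sum_nil]; exact hasDerivAt_const u (0 : ℝ)
  | cons s H ih =>
    have h := (((hasDerivAt_axisFacUV s.1 u).mul_const (axisFacUV s.2.1 v)).const_mul (s.2.2 : ℝ)).add ih
    simp only [rbBandUV, rbBandU, List.map_cons, List.sum_cons]
    exact h

/-- `∂ε/∂v (u, v) = rbBandU (rbT H) v u`. [folklore] -/
theorem hasDerivAt_rbBandUV_v (H : List (ℕ × ℕ × ℚ)) (u v : ℝ) :
    HasDerivAt (fun v => rbBandUV H u v) (rbBandU (rbT H) v u) v := by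
  have hf : (fun v => rbBandUV H u v) = fun v => rbBandUV (rbT H) v u := funext fun w => rbBandUV_transpose H u w
  rw [hf]; exact hasDerivAt_rbBandUV (rbT H) v u

/-- The band polynomial is jointly continuous. [folklore] -/
theorem continuous_rbBandUV₂ (H : List (ℕ × ℕ × ℚ)) : Continuous (fun p : ℝ × ℝ => rbBandUV H p.1 p.2) := by
  have hc : ∀ j : ℕ, Continuous (fun p : ℝ × ℝ => axisFacUV j p.1) := by
    intro j; unfold axisFacUV; split_ifs
    · exact continuous_const
    · exact continuous_const.mul ((continuous_cheb j).comp continuous_fst)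
  have hd : ∀ j : ℕ, Continuous (fun p : ℝ × ℝ => axisFacUV j p.2) := by
    intro j; unfold axisFacUV; split_ifs
    · exact continuous_const
    · exact continuous_const.mul ((continuous_cheb j).comp continuous_snd)
  induction H with
  | nil => simpa [rbBandUV] using continuous_const
  | cons s H ih =>
    have h : Continuous fun p : ℝ × ℝ => (s.2.2 : ℝ) * (axisFacUV s.1 p.1 * axisFacUV s.2.1 p.2) + rbBandUV H p.1 p.2 :=
      ((continuous_const (y := (s.2.2 : ℝ))).mul ((hc s.1).mul (hd s.2.1))).add ih
    simpa [rbBandUV, List.map_cons, List.sum_cons] using h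

/-- Axis factor as an `ArithExpr` in the sub-term `e`. [folklore] -/
def axisFacE (m : ℕ) (e : ArithExpr) : ArithExpr := if m = 0 then .const 1 else .mul (.const 2) (chebE m e)

/-- Derivative axis factor as an `ArithExpr`. [folklore] -/
def dAxisFacE (m : ℕ) (e : ArithExpr) : ArithExpr := if m = 0 then .const 0 else .mul (.const 2) (dchebE m e)

/-- [folklore] -/
theorem eval_axisFacE (m : ℕ) (e : ArithExpr) (x : ℕ → ℝ) : (axisFacE m e).eval x = axisFacUV m (e.eval x) := by
  unfold axisFacE axisFacUV; split_ifs <;> simp [eval_chebE]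

/-- [folklore] -/
theorem eval_dAxisFacE (m : ℕ) (e : ArithExpr) (x : ℕ → ℝ) : (dAxisFacE m e).eval x = dAxisFacUV m (e.eval x) := by
  unfold dAxisFacE dAxisFacUV; split_ifs <;> simp [eval_dchebE]

/-- The band polynomial in sub-terms `eu, ev`. [folklore] -/
def rbBandGE (H : List (ℕ × ℕ × ℚ)) (eu ev : ArithExpr) : ArithExpr :=
  H.foldr (fun s acc => .add (.mul (.const s.2.2) (.mul (axisFacE s.1 eu) (axisFacE s.2.1 ev))) acc) (.const 0)

/-- `∂_u` band polynomial in sub-terms `eu, ev`. [folklore] -/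
def rbBandUGE (H : List (ℕ × ℕ × ℚ)) (eu ev : ArithExpr) : ArithExpr :=
  H.foldr (fun s acc => .add (.mul (.const s.2.2) (.mul (dAxisFacE s.1 eu) (axisFacE s.2.1 ev))) acc) (.const 0)

/-- [folklore] -/
theorem eval_rbBandGE (H : List (ℕ × ℕ × ℚ)) (eu ev : ArithExpr) (x : ℕ → ℝ) :
    (rbBandGE H eu ev).eval x = rbBandUV H (eu.eval x) (ev.eval x) := by
  induction H with
  | nil => simp [rbBandGE, rbBandUV]
  | cons s H ih =>
    simp only [rbBandGE, List.foldr_cons, ArithExpr.eval_add, ArithExpr.eval_mul, ArithExpr.eval_const,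
      eval_axisFacE, rbBandUV, List.map_cons, List.sum_cons] at ih ⊢
    rw [ih]

/-- [folklore] -/
theorem eval_rbBandUGE (H : List (ℕ × ℕ × ℚ)) (eu ev : ArithExpr) (x : ℕ → ℝ) :
    (rbBandUGE H eu ev).eval x = rbBandU H (eu.eval x) (ev.eval x) := by
  induction H with
  | nil => simp [rbBandUGE, rbBandU]
  | cons s H ih =>
    simp only [rbBandUGE, List.foldr_cons, ArithExpr.eval_add, ArithExpr.eval_mul, ArithExpr.eval_const,
      eval_axisFacE, eval_dAxisFacE, rbBandU, List.map_cons, List.sum_cons] at ih ⊢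
    rw [ih]

/-- The band `ε(u, v)` on `(x 0, x 1)`. [folklore] -/
def rbBandE (H : List (ℕ × ℕ × ℚ)) : ArithExpr := rbBandGE H (.var 0) (.var 1)

/-- `∂_u ε(u, v)` on `(x 0, x 1)`. [folklore] -/
def rbBandUE (H : List (ℕ × ℕ × ℚ)) : ArithExpr := rbBandUGE H (.var 0) (.var 1)

/-- `∂_v ε(u, v) = ∂_u ε_{Hᵀ}(v, u)` on `(x 0, x 1)`. [folklore] -/
def rbBandVE (H : List (ℕ × ℕ × ℚ)) : ArithExpr := rbBandUGE (rbT H) (.var 1) (.var 0)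

/-- [folklore] -/
@[simp] theorem eval_rbBandE (H : List (ℕ × ℕ × ℚ)) (x : ℕ → ℝ) : (rbBandE H).eval x = rbBandUV H (x 0) (x 1) := by
  simp [rbBandE, eval_rbBandGE]

/-- [folklore] -/
@[simp] theorem eval_rbBandUE (H : List (ℕ × ℕ × ℚ)) (x : ℕ → ℝ) : (rbBandUE H).eval x = rbBandU H (x 0) (x 1) := by
  simp [rbBandUE, eval_rbBandUGE]

/-- [folklore] -/
@[simp] theorem eval_rbBandVE (H : List (ℕ × ℕ × ℚ)) (x : ℕ → ℝ) :
    (rbBandVE H).eval x = rbBandU (rbT H) (x 1) (x 0) := by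
  simp [rbBandVE, eval_rbBandUGE]

/-- The energy at X = (π, 0) is the rational `rbBandQ H (−1) 1`; at Y = (0, π) it is `rbBandQ H 1 (−1)`. [folklore] -/
theorem rbBandK_X {H : List (ℕ × ℕ × ℚ)} (hH : shellsOK H = true) : rbBandK H π 0 = ((rbBandQ H (-1) 1 : ℚ) : ℝ) := by
  rw [rbBandK_eq_UV hH, cos_pi, cos_zero, cast_rbBandQ]; norm_num

/-- [folklore] -/
theorem rbBandK_Y {H : List (ℕ × ℕ × ℚ)} (hH : shellsOK H = true) : rbBandK H 0 π = ((rbBandQ H 1 (-1) : ℚ) : ℝ) := by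
  rw [rbBandK_eq_UV hH, cos_pi, cos_zero, cast_rbBandQ]; norm_num

end Summit.Ventures.CertifiedManyBodySolver.Downfold.Emery
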